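import Summits.AnomalousDissipation.AnomalousDissipation.Theorems.SolenoidalFractalHomogenisationLagrangianStepSidebandXSlowEquation
import Literature.Analysis.ODE.LinearPeriodicAveragingForced
import HarnessLib

/-!
# K1L_D `LagrangianRenormalisationStepDesign` (stmt-AnomalousDissipation-27980), `stub_D1_V0` (V0 = clause (ii) of
# `WCrossing.D1ExactFamily`), brick T6: THE SLOW MODE IS AVERAGED — `‖x t − exp(−tḠ) x 0‖ ≤ M·L P₁(1 + (2‖Ḡ‖+L)/r_lo) + ρ₀(min(t,1/r_lo) + L P₁/r_lo)`
# for ANY coercive `Ḡ` agreeing with `4π²P_ℓT_{𝔹ᵀ}(ℓ) + slowMean` on `ℓ`-transversal vectors (coercivity is a HYPOTHESIS here — finding F-w1g7-1)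
# (helper; `--kind proof --supports stmt-AnomalousDissipation-27980 --as helper`)

Summits-side helper file of route `SolenoidalFractalHomogenisation` (prover seat `ad-k1l-cellLawV-w1` g7; 0 sorry, no defs, no named facts).  Brick T6 of the
V0 memo `Cruxes/LagrangianRenormalisationStepDesign/Lines/onelevel-V0-residual.md` §4: the forced first-order averaging lemma
`Literature.Analysis.ODE.PeriodicAveraging.norm_sub_exp_apply_le_forced` applied to the slow mode `x = modeRep … ℓ` of THE weak solution, with the forced
slow equation `…SidebandXSlowEquation.hasDerivAt_slow_forced`, the perturbation `g := slowPert − slowMean` (continuous, `‖g‖ ≤ L := 2ξ²C_fC_N`, window means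
EXACTLY zero by `integral_slowPert_eq`), the forcing `slowForcing` (bound `ρ₀` supplied by the caller from T4d) and the a priori bound `M` (supplied by the
caller from the energy inequality).  The averaged generator `Ḡ : ℂ³ →L[ℝ] ℂ³` is ANY operator with `Ḡ v = 4π²P_ℓT_{𝔹ᵀ}(ℓ)v + slowMean v` on `ℓ`-transversal
`v`, coercive with rate `r_lo > 0` — the coercivity is NOT proved here (it is the quantitative ellipticity of `psiStar`, cell finding F-w1g7-1).
* `norm_slowMean_le` — `‖slowMean‖ ≤ ξ²·C_f·C_N`; `norm_slowPert_sub_slowMean_le` — `‖slowPert s − slowMean‖ ≤ 2ξ²C_fC_N`;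
* `integral_slowPert_sub_slowMean_window` — `∫_{kP}^{(k+1)P} (slowPert − slowMean) = 0`;
* **`norm_modeRep_sub_exp_le`** — the averaged estimate above, for every `t ∈ [0,T]`.
NOT a proof of any registered stub, of K1L_D, or of anomalous dissipation; rung F-D1.A0 infrastructure.
-/

set_option linter.dupNamespace false

noncomputable section

namespace Summit.AnomalousDissipation.AnomalousDissipation.Theorems.SolenoidalFractalHomogenisation.LagrangianStep.Sideband

open Set MeasureTheory Complex UnitAddTorus Filter Topology intervalIntegral NormedSpace
open scoped InnerProductSpace
open Literature.Analysis Literature.Analysis.FunctionSpaces Literature.Analysis.FunctionSpaces.Torus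
open Literature.Analysis.FluidPDE Literature.Analysis.FluidPDE.Torus Literature.Analysis.FluidPDE.LatticeShear
open Literature.Analysis.ODE.PeriodicAveraging (norm_sub_exp_apply_le_forced)
open Summit.AnomalousDissipation.AnomalousDissipation.Theorems.SolenoidalFractalHomogenisation.LagrangianStep.CellChain
  (modeRep continuousOn_modeRep)
open Summit.AnomalousDissipation.AnomalousDissipation.Theorems.SolenoidalFractalHomogenisation.PermissibleCarrier (period_pos)

variable {k₀ : ℕ}

/-! ## §1 The mean and the mean-free perturbation -/

/-- **`‖slowMean‖ ≤ ξ²·C_f·C_N`** (`P • slowMean = ∫₀ᴾ slowPert`). [cite: SandersVerhulstMurdock2007, Theorem 2.8.1] -/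
theorem norm_slowMean_le (W₁ : LatticeWord k₀) (n : ℕ) (ℓ : Fin 3 → ℤ) {𝔸 : Torus.Visc4 (Fin 3)} {lo hi : ℝ}
    (h𝔸 : Torus.NearIso 𝔸 lo hi) (hlo : 0 < lo) (R : ℕ) :
    ‖slowMean W₁ n ℓ 𝔸 R‖ ≤ (Real.sqrt (freqNormSq ℓ) / n) ^ 2 *
      (∑ j, 4 * Real.pi * ‖slotAmp W₁ j‖) * (∑ j, 8 * Real.pi * ‖slotAmp W₁ j‖ / min 1 (4 * Real.pi ^ 2 * lo)) := by
  have hP := period_pos W₁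
  have hint := integral_slowPert_eq W₁ n ℓ h𝔸 hlo R 0
  rw [zero_add] at hint
  have hb : ‖∫ s in (0:ℝ)..W₁.period, slowPert W₁ n ℓ 𝔸 R s‖ ≤ ((Real.sqrt (freqNormSq ℓ) / n) ^ 2 *
      (∑ j, 4 * Real.pi * ‖slotAmp W₁ j‖) * (∑ j, 8 * Real.pi * ‖slotAmp W₁ j‖ / min 1 (4 * Real.pi ^ 2 * lo))) * |W₁.period - 0| :=
    norm_integral_le_of_norm_le_const fun s _ => norm_slowPert_le W₁ n ℓ h𝔸 hlo R s
  rw [hint, sub_zero, abs_of_pos hP, norm_smul, Real.norm_eq_abs, abs_of_pos hP] at hb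
  nlinarith [hb, hP, norm_nonneg (slowMean W₁ n ℓ 𝔸 R)]

/-- **`‖slowPert s − slowMean‖ ≤ 2ξ²·C_f·C_N`.** [cite: SandersVerhulstMurdock2007, Theorem 2.8.1] -/
theorem norm_slowPert_sub_slowMean_le (W₁ : LatticeWord k₀) (n : ℕ) (ℓ : Fin 3 → ℤ) {𝔸 : Torus.Visc4 (Fin 3)} {lo hi : ℝ}
    (h𝔸 : Torus.NearIso 𝔸 lo hi) (hlo : 0 < lo) (R : ℕ) (s : ℝ) :
    ‖slowPert W₁ n ℓ 𝔸 R s - slowMean W₁ n ℓ 𝔸 R‖ ≤ 2 * ((Real.sqrt (freqNormSq ℓ) / n) ^ 2 *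
      (∑ j, 4 * Real.pi * ‖slotAmp W₁ j‖) * (∑ j, 8 * Real.pi * ‖slotAmp W₁ j‖ / min 1 (4 * Real.pi ^ 2 * lo))) := by
  have h1 := norm_slowPert_le W₁ n ℓ h𝔸 hlo R s
  have h2 := norm_slowMean_le W₁ n ℓ h𝔸 hlo R
  linarith [norm_sub_le (slowPert W₁ n ℓ 𝔸 R s) (slowMean W₁ n ℓ 𝔸 R)]

/-- **The window means of the mean-free perturbation vanish**: `∫_{kP}^{(k+1)P} (slowPert − slowMean) = 0`.
[cite: SandersVerhulstMurdock2007, Lemma 2.8.2 (Besjes)] -/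
theorem integral_slowPert_sub_slowMean_window (W₁ : LatticeWord k₀) (n : ℕ) (ℓ : Fin 3 → ℤ) {𝔸 : Torus.Visc4 (Fin 3)} {lo hi : ℝ}
    (h𝔸 : Torus.NearIso 𝔸 lo hi) (hlo : 0 < lo) (R : ℕ) (k : ℕ) :
    ∫ s in ((k : ℝ) * W₁.period)..(((k : ℝ) + 1) * W₁.period), (slowPert W₁ n ℓ 𝔸 R s - slowMean W₁ n ℓ 𝔸 R) = 0 := by
  have hk : ((k : ℝ) + 1) * W₁.period = (k : ℝ) * W₁.period + W₁.period := by ring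
  rw [intervalIntegral.integral_sub ((continuous_slowPert W₁ n ℓ h𝔸 hlo R).intervalIntegrable _ _) intervalIntegrable_const,
    intervalIntegral.integral_const, hk, integral_slowPert_eq W₁ n ℓ h𝔸 hlo R, add_sub_cancel_left, sub_self]

/-! ## §2 The averaged slow mode -/

/-- **THE SLOW MODE IS AVERAGED (T6)**: let `Ḡ : ℂ³ →L[ℝ] ℂ³` satisfy `Ḡ v = 4π²P_ℓT_{𝔹ᵀ}(ℓ) v + slowMean v` on `ℓ`-transversal `v` (`𝔹 = (1/n²)•𝔸`), be
coercive (`r_lo‖v‖² ≤ ⟪Ḡv, v⟫_ℝ`, `r_lo > 0`) with `‖Ḡ‖ ≤ Gn`; let `‖x s‖ ≤ M` and `‖slowForcing s‖ ≤ ρ₀` on `[0,t] ⊆ [0,T]`.  Then, with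
`L := 2ξ²C_fC_N` and `P₁ := W₁.period`,  `‖x t − exp(−tḠ)(x 0)‖ ≤ M·L P₁(1 + (2Gn + L)/r_lo) + ρ₀·(min(t, 1/r_lo) + L P₁/r_lo)` (no `η`-term: the window
means of `slowPert − slowMean` vanish EXACTLY). [cite: SandersVerhulstMurdock2007, Theorem 2.8.1 and Theorem 5.5.1, inhomogeneous linear case]
[cite: MajdaKramer1999, §2.2.1.3 (55)] -/
theorem norm_modeRep_sub_exp_le (W₁ : LatticeWord k₀) {n : ℕ} {T : ℝ} {𝔸 : Torus.Visc4 (Fin 3)} {lo hi : ℝ}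
    (h𝔸 : Torus.NearIso 𝔸 lo hi) (hlo : 0 < lo)
    {F : UnitAddTorus (Fin 3) → EuclideanSpace ℝ (Fin 3)} {w : ℝ → UnitAddTorus (Fin 3) → EuclideanSpace ℝ (Fin 3)}
    (h : Torus.IsWeakTensorPassiveVectorOn 0 T ((1 / (n : ℝ) ^ 2) • 𝔸) (W₁.cell n) F w) (hF : Integrable F volume) {ℓ : Fin 3 → ℤ}
    {R : ℕ} (hbox : ∀ j, (W₁.phase j).m ∈ box R)
    (G : EuclideanSpace ℂ (Fin 3) →L[ℝ] EuclideanSpace ℂ (Fin 3)) {rlo Gn M ρ₀ : ℝ} (hrlo : 0 < rlo)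
    (hcoer : ∀ v : EuclideanSpace ℂ (Fin 3), rlo * ‖v‖ ^ 2 ≤ ⟪G v, v⟫_ℝ) (hGn : ‖G‖ ≤ Gn)
    (hGx : ∀ v : EuclideanSpace ℂ (Fin 3), transversalProj ℓ v = v →
      G v = (((4 * Real.pi ^ 2 : ℝ) : ℂ)) • transversalProj ℓ (Torus.symbT (Torus.majorTranspose ((1 / (n : ℝ) ^ 2) • 𝔸)) ℓ v) +
        slowMean W₁ n ℓ 𝔸 R v)
    {t : ℝ} (ht : t ∈ Icc 0 T)
    (hM : ∀ s ∈ Icc 0 t, ‖modeRep W₁ n ((1 / (n : ℝ) ^ 2) • 𝔸) F w ℓ s‖ ≤ M)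
    (hρ : ∀ s ∈ Icc 0 t, ‖slowForcing W₁ n ℓ 𝔸 R F w s‖ ≤ ρ₀) :
    ‖modeRep W₁ n ((1 / (n : ℝ) ^ 2) • 𝔸) F w ℓ t - exp (-(t • G)) (modeRep W₁ n ((1 / (n : ℝ) ^ 2) • 𝔸) F w ℓ 0)‖ ≤
      M * (2 * ((Real.sqrt (freqNormSq ℓ) / n) ^ 2 * (∑ j, 4 * Real.pi * ‖slotAmp W₁ j‖) *
            (∑ j, 8 * Real.pi * ‖slotAmp W₁ j‖ / min 1 (4 * Real.pi ^ 2 * lo))) * W₁.period *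
          (1 + (2 * Gn + 2 * ((Real.sqrt (freqNormSq ℓ) / n) ^ 2 * (∑ j, 4 * Real.pi * ‖slotAmp W₁ j‖) *
            (∑ j, 8 * Real.pi * ‖slotAmp W₁ j‖ / min 1 (4 * Real.pi ^ 2 * lo)))) / rlo)) +
      ρ₀ * (min t (1 / rlo) + 2 * ((Real.sqrt (freqNormSq ℓ) / n) ^ 2 * (∑ j, 4 * Real.pi * ‖slotAmp W₁ j‖) *
            (∑ j, 8 * Real.pi * ‖slotAmp W₁ j‖ / min 1 (4 * Real.pi ^ 2 * lo))) * W₁.period / rlo) := by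
  have hT : 0 ≤ T := ht.1.trans ht.2
  have hP := period_pos W₁
  -- the data of the forced averaging lemma
  have hg : Continuous fun s => slowPert W₁ n ℓ 𝔸 R s - slowMean W₁ n ℓ 𝔸 R :=
    (continuous_slowPert W₁ n ℓ h𝔸 hlo R).sub continuous_const
  have hxc : ContinuousOn (modeRep W₁ n ((1 / (n : ℝ) ^ 2) • 𝔸) F w ℓ) (Icc 0 t) :=
    (continuousOn_modeRep W₁ n hT h ℓ).mono (Icc_subset_Icc_right ht.2)
  have hρc : ContinuousOn (slowForcing W₁ n ℓ 𝔸 R F w) (Icc 0 t) :=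
    (continuousOn_slowForcing W₁ ℓ h𝔸 hlo R hT h).mono (Icc_subset_Icc_right ht.2)
  have hL : ∀ s ∈ Icc 0 t, ‖slowPert W₁ n ℓ 𝔸 R s - slowMean W₁ n ℓ 𝔸 R‖ ≤ 2 * ((Real.sqrt (freqNormSq ℓ) / n) ^ 2 *
      (∑ j, 4 * Real.pi * ‖slotAmp W₁ j‖) * (∑ j, 8 * Real.pi * ‖slotAmp W₁ j‖ / min 1 (4 * Real.pi ^ 2 * lo))) :=
    fun s _ => norm_slowPert_sub_slowMean_le W₁ n ℓ h𝔸 hlo R s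
  have hmean : ∀ k : ℕ, ((k : ℝ) + 1) * W₁.period ≤ t →
      ‖∫ s in ((k : ℝ) * W₁.period)..(((k : ℝ) + 1) * W₁.period), (slowPert W₁ n ℓ 𝔸 R s - slowMean W₁ n ℓ 𝔸 R)‖ ≤ 0 * W₁.period := by
    intro k _
    rw [integral_slowPert_sub_slowMean_window W₁ n ℓ h𝔸 hlo R k, norm_zero, zero_mul]
  have hx : ∀ s ∈ Ioo 0 t, HasDerivAt (modeRep W₁ n ((1 / (n : ℝ) ^ 2) • 𝔸) F w ℓ)
      (-(G (modeRep W₁ n ((1 / (n : ℝ) ^ 2) • 𝔸) F w ℓ s) +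
          (slowPert W₁ n ℓ 𝔸 R s - slowMean W₁ n ℓ 𝔸 R) (modeRep W₁ n ((1 / (n : ℝ) ^ 2) • 𝔸) F w ℓ s)) +
        slowForcing W₁ n ℓ 𝔸 R F w s) s := by
    intro s hs
    have hsT : s ∈ Ioo 0 T := ⟨hs.1, hs.2.trans_le ht.2⟩
    have htr : transversalProj ℓ (modeRep W₁ n ((1 / (n : ℝ) ^ 2) • 𝔸) F w ℓ s) = modeRep W₁ n ((1 / (n : ℝ) ^ 2) • 𝔸) F w ℓ s :=
      transversalProj_modeRep W₁ n hT h ℓ ⟨hs.1.le, hsT.2.le⟩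
    refine (hasDerivAt_slow_forced W₁ n h hF ℓ hbox hsT).congr_deriv ?_
    rw [hGx _ htr, sub_apply]
    abel
  have hmain := norm_sub_exp_apply_le_forced G hg (modeRep W₁ n ((1 / (n : ℝ) ^ 2) • 𝔸) F w ℓ) hrlo hP le_rfl ht.1 hcoer hGn hL hmean
    hxc hρc hx hM hρ
  simpa only [zero_mul, zero_add] using hmain

end Summit.AnomalousDissipation.AnomalousDissipation.Theorems.SolenoidalFractalHomogenisation.LagrangianStep.Sideband

end
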